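import Mathlib.Analysis.SpecialFunctions.Pow.Real
import Mathlib.Algebra.Order.BigOperators.Group.Finset
import Mathlib.Algebra.BigOperators.Ring.Finset
import HarnessLib

/-!
# Threshold cycle-weight models: the expected number of cycles is monotone in the number of points

Support file for the Sahi / Conjecture-P programme of route `PercNearOneGluingNoHeavy`
(`--supports stmt-CriticalPhenomena-4575`, prover prim-l12-p5 gen 23; proof note
`prim-l12-p5/LENGTH-GCL-g23.md`, Theorem TH).  No definitions, no named facts, no sorries; standard
axioms.  Everything is stated for two real sequences `u v : ℕ → ℝ` satisfying explicit hypotheses.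

## The model and why only two recurrences are needed

Fix a threshold `k = k₀ + 1 ≥ 1` and an Ewens tilt `t > 0`, and let `P_m` be the probability measure on
the permutations of `m` points all of whose cycles have length `≥ k`, with weight `t ^ (#cycles)`.
Write `u m := Z_m / m!` (normalised partition function) and
`v m := (∑_σ #cycles(σ) · t^{#cycles σ}) / m!`, so that `κ_m := v m / u m` is the expected number of
cycles.  The exponential formula `∑ u_m x^m = exp (t Λ_k)`, `Λ_k = ∑_{j ≥ k} x^j / j`,
`(1-x) Λ_k' = x^{k-1}`, gives the two linear recurrences used as hypotheses below:
`(n+k) u_{n+k} = (n+k-1) u_{n+k-1} + t u_n` and `(n+k) v_{n+k} = (n+k-1) v_{n+k-1} + t (u_n + v_n)`,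
together with `u_0 = 1`, `v_0 = 0` and `u_j = v_j = 0` for `0 < j < k` (no permutation of `j` points
has all cycles of length `≥ k`).  Probabilistically: `κ_{m+1}` is a convex combination of `κ_m` (the
point `m+1` lies in a cycle of length `> k`: delete it) and of `1 + κ_{m+1-k}` (it lies in a cycle of
length exactly `k`: remove that cycle) — `kappa_step`.

## Results (all elementary, from the recurrences only)

* `kappa_mono` : `κ` is nondecreasing on `[k, ∞)`;
* `kappa_le_one_add` : `κ_{n+k₀} ≤ 1 + κ_n` for `n ≥ k` ("`k-1` more points add at most one expected
  cycle");
* `upper_mean_ge_lower_mean` : for arbitrary nonnegative weights `w` and every cut `M`,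
  `(∑_{M ≤ r < N} w_r v_r)(∑_{r < M} w_r u_r) ≥ (∑_{M ≤ r < N} w_r u_r)(∑_{r < M} w_r v_r)`.
  With `N = n` and `w_r := t·[n - r ≥ k]` one has `w_r u_r ∝ P_n(R = r)` for the number `R` of points
  outside the cycle of a fixed point, and `w_r v_r ∝ P_n(R = r) κ_r`, so the inequality reads
  `E[#cycles | L ≤ J] ≥ E[#cycles | L > J]` (`L = n - R` the length of the cycle of the fixed point,
  `J = n - M`), i.e. `Cov(#cycles, #points in cycles of length ≤ J) ≥ 0` for every `n, J, k, t` — the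
  threshold case of conjecture GC-L of the programme (the size-biased cycle length is stochastically
  decreasing in the fugacity), cf. the proof note §5–§6.
-/

namespace Summit.CriticalPhenomena.PercolationContinuityZ3.Theorems

namespace ThresholdCycles

open Finset

variable {k₀ : ℕ} {t : ℝ} {u v : ℕ → ℝ}

/-- `u` is nonnegative everywhere (from `u_0 = 1`, the vanishing below the threshold and the
`u`-recurrence with `t > 0`). -/
theorem u_nonneg (ht : 0 < t) (hu0 : u 0 = 1) (hus : ∀ j, 0 < j → j ≤ k₀ → u j = 0)
    (hur : ∀ n, ((n + k₀ + 1 : ℕ) : ℝ) * u (n + k₀ + 1) = ((n + k₀ : ℕ) : ℝ) * u (n + k₀) + t * u n) :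
    ∀ n, 0 ≤ u n := by
  intro n
  induction n using Nat.strong_induction_on with
  | _ n ih =>
    rcases Nat.eq_zero_or_pos n with rfl | hn
    · rw [hu0]; exact zero_le_one
    by_cases hsmall : n ≤ k₀
    · rw [hus n hn hsmall]
    · obtain ⟨m, rfl⟩ : ∃ m, n = m + k₀ + 1 := ⟨n - (k₀ + 1), by omega⟩
      have hrec := hur m
      have h1 : 0 ≤ u (m + k₀) := ih _ (by omega)
      have h2 : 0 ≤ u m := ih _ (by omega)
      have hpos : (0 : ℝ) < ((m + k₀ + 1 : ℕ) : ℝ) := by positivity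
      have : 0 ≤ ((m + k₀ : ℕ) : ℝ) * u (m + k₀) + t * u m := by positivity
      rw [← hrec] at this
      exact (mul_nonneg_iff_of_pos_left hpos).1 this

/-- `v` is nonnegative everywhere. -/
theorem v_nonneg (ht : 0 < t) (hu0 : u 0 = 1) (hv0 : v 0 = 0)
    (hus : ∀ j, 0 < j → j ≤ k₀ → u j = 0) (hvs : ∀ j, 0 < j → j ≤ k₀ → v j = 0)
    (hur : ∀ n, ((n + k₀ + 1 : ℕ) : ℝ) * u (n + k₀ + 1) = ((n + k₀ : ℕ) : ℝ) * u (n + k₀) + t * u n)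
    (hvr : ∀ n, ((n + k₀ + 1 : ℕ) : ℝ) * v (n + k₀ + 1) =
      ((n + k₀ : ℕ) : ℝ) * v (n + k₀) + t * (u n + v n)) :
    ∀ n, 0 ≤ v n := by
  intro n
  induction n using Nat.strong_induction_on with
  | _ n ih =>
    rcases Nat.eq_zero_or_pos n with rfl | hn
    · rw [hv0]
    by_cases hsmall : n ≤ k₀
    · rw [hvs n hn hsmall]
    · obtain ⟨m, rfl⟩ : ∃ m, n = m + k₀ + 1 := ⟨n - (k₀ + 1), by omega⟩
      have hrec := hvr m
      have h1 : 0 ≤ v (m + k₀) := ih _ (by omega)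
      have h2 : 0 ≤ v m := ih _ (by omega)
      have h3 : 0 ≤ u m := u_nonneg ht hu0 hus hur m
      have hpos : (0 : ℝ) < ((m + k₀ + 1 : ℕ) : ℝ) := by positivity
      have : 0 ≤ ((m + k₀ : ℕ) : ℝ) * v (m + k₀) + t * (u m + v m) := by positivity
      rw [← hrec] at this
      exact (mul_nonneg_iff_of_pos_left hpos).1 this

/-- `(k₀+1) u_{k₀+1} = t`: the first nonempty level (a single `k`-cycle). -/
theorem u_level (hu0 : u 0 = 1) (hus : ∀ j, 0 < j → j ≤ k₀ → u j = 0)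
    (hur : ∀ n, ((n + k₀ + 1 : ℕ) : ℝ) * u (n + k₀ + 1) = ((n + k₀ : ℕ) : ℝ) * u (n + k₀) + t * u n) :
    ((k₀ + 1 : ℕ) : ℝ) * u (k₀ + 1) = t := by
  have hrec := hur 0
  simp only [Nat.zero_add] at hrec
  rw [hrec, hu0, mul_one]
  rcases Nat.eq_zero_or_pos k₀ with hk | hk
  · subst hk; simp
  · rw [hus k₀ hk le_rfl]; ring

/-- `(k₀+1) v_{k₀+1} = t` as well. -/
theorem v_level (hu0 : u 0 = 1) (hv0 : v 0 = 0) (hvs : ∀ j, 0 < j → j ≤ k₀ → v j = 0)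
    (hvr : ∀ n, ((n + k₀ + 1 : ℕ) : ℝ) * v (n + k₀ + 1) =
      ((n + k₀ : ℕ) : ℝ) * v (n + k₀) + t * (u n + v n)) :
    ((k₀ + 1 : ℕ) : ℝ) * v (k₀ + 1) = t := by
  have hrec := hvr 0
  simp only [Nat.zero_add] at hrec
  rw [hrec, hu0, hv0, add_zero, mul_one]
  rcases Nat.eq_zero_or_pos k₀ with hk | hk
  · subst hk; simp
  · rw [hvs k₀ hk le_rfl]; ring

/-- `u_m > 0` for every `m ≥ k₀ + 1`. -/
theorem u_pos (ht : 0 < t) (hu0 : u 0 = 1) (hus : ∀ j, 0 < j → j ≤ k₀ → u j = 0)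
    (hur : ∀ n, ((n + k₀ + 1 : ℕ) : ℝ) * u (n + k₀ + 1) = ((n + k₀ : ℕ) : ℝ) * u (n + k₀) + t * u n) :
    ∀ m, k₀ + 1 ≤ m → 0 < u m := by
  intro m hm
  induction m, hm using Nat.le_induction with
  | base =>
    have hl := u_level hu0 hus hur
    have hpos : (0 : ℝ) < ((k₀ + 1 : ℕ) : ℝ) := by positivity
    have : 0 < ((k₀ + 1 : ℕ) : ℝ) * u (k₀ + 1) := by rw [hl]; exact ht
    exact (mul_pos_iff_of_pos_left hpos).1 this
  | succ m hm ih =>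
    obtain ⟨n, hn⟩ : ∃ n, m = n + k₀ := ⟨m - k₀, by omega⟩
    have hrec := hur n
    rw [← hn] at hrec
    have hpos : (0 : ℝ) < ((m + 1 : ℕ) : ℝ) := by positivity
    have hmpos : (0 : ℝ) < ((m : ℕ) : ℝ) := by exact_mod_cast (show 0 < m by omega)
    have : 0 < ((m : ℕ) : ℝ) * u m + t * u n := by
      have h1 : 0 < ((m : ℕ) : ℝ) * u m := mul_pos hmpos ih
      have h2 : 0 ≤ t * u n := mul_nonneg ht.le (u_nonneg ht hu0 hus hur n)
      linarith
    rw [← hrec] at this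
    exact (mul_pos_iff_of_pos_left hpos).1 this

/-- On the first block `k₀+1 ≤ m ≤ 2k₀+1` every admissible permutation is a single cycle: `v_m = u_m`. -/
theorem v_eq_u_of_le (hu0 : u 0 = 1) (hv0 : v 0 = 0)
    (hus : ∀ j, 0 < j → j ≤ k₀ → u j = 0) (hvs : ∀ j, 0 < j → j ≤ k₀ → v j = 0)
    (hur : ∀ n, ((n + k₀ + 1 : ℕ) : ℝ) * u (n + k₀ + 1) = ((n + k₀ : ℕ) : ℝ) * u (n + k₀) + t * u n)
    (hvr : ∀ n, ((n + k₀ + 1 : ℕ) : ℝ) * v (n + k₀ + 1) =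
      ((n + k₀ : ℕ) : ℝ) * v (n + k₀) + t * (u n + v n)) :
    ∀ m, k₀ + 1 ≤ m → m ≤ 2 * k₀ + 1 → v m = u m := by
  intro m hm
  induction m, hm using Nat.le_induction with
  | base =>
    intro _
    have hu := u_level hu0 hus hur
    have hv := v_level hu0 hv0 hvs hvr
    have hpos : (0 : ℝ) < ((k₀ + 1 : ℕ) : ℝ) := by positivity
    have : ((k₀ + 1 : ℕ) : ℝ) * v (k₀ + 1) = ((k₀ + 1 : ℕ) : ℝ) * u (k₀ + 1) := by rw [hu, hv]
    exact mul_left_cancel₀ hpos.ne' this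
  | succ m hm ih =>
    intro hm2
    obtain ⟨n, hn⟩ : ∃ n, m = n + k₀ := ⟨m - k₀, by omega⟩
    have hn1 : 0 < n := by omega
    have hn2 : n ≤ k₀ := by omega
    have hrecu := hur n
    have hrecv := hvr n
    rw [← hn] at hrecu hrecv
    rw [hus n hn1 hn2, hvs n hn1 hn2] at hrecv
    rw [hus n hn1 hn2] at hrecu
    have ih' := ih (by omega)
    have hpos : (0 : ℝ) < ((m + 1 : ℕ) : ℝ) := by positivity
    have : ((m + 1 : ℕ) : ℝ) * v (m + 1) = ((m + 1 : ℕ) : ℝ) * u (m + 1) := by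
      rw [hrecu, hrecv, ih']; ring
    exact mul_left_cancel₀ hpos.ne' this

/-- `κ_m = v_m/u_m = 1` on the first block. -/
theorem kappa_eq_one_of_le (ht : 0 < t) (hu0 : u 0 = 1) (hv0 : v 0 = 0)
    (hus : ∀ j, 0 < j → j ≤ k₀ → u j = 0) (hvs : ∀ j, 0 < j → j ≤ k₀ → v j = 0)
    (hur : ∀ n, ((n + k₀ + 1 : ℕ) : ℝ) * u (n + k₀ + 1) = ((n + k₀ : ℕ) : ℝ) * u (n + k₀) + t * u n)
    (hvr : ∀ n, ((n + k₀ + 1 : ℕ) : ℝ) * v (n + k₀ + 1) =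
      ((n + k₀ : ℕ) : ℝ) * v (n + k₀) + t * (u n + v n))
    (m : ℕ) (hm : k₀ + 1 ≤ m) (hm' : m ≤ 2 * k₀ + 1) : v m / u m = 1 := by
  rw [v_eq_u_of_le hu0 hv0 hus hvs hur hvr m hm hm']
  exact div_self (u_pos ht hu0 hus hur m hm).ne'

/-- **The convex-combination step.**  For `n + k₀ ≥ k₀ + 1`:
`κ_{n+k₀+1} - κ_{n+k₀} = a · (1 + κ_n - κ_{n+k₀})` with `a = t u_n / ((n+k₀+1) u_{n+k₀+1}) ≥ 0`
(here `κ_j := v_j/u_j`; when `u_n = 0` both sides vanish). -/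
theorem kappa_step (ht : 0 < t) (hu0 : u 0 = 1)
    (hus : ∀ j, 0 < j → j ≤ k₀ → u j = 0) (hvs : ∀ j, 0 < j → j ≤ k₀ → v j = 0)
    (hur : ∀ n, ((n + k₀ + 1 : ℕ) : ℝ) * u (n + k₀ + 1) = ((n + k₀ : ℕ) : ℝ) * u (n + k₀) + t * u n)
    (hvr : ∀ n, ((n + k₀ + 1 : ℕ) : ℝ) * v (n + k₀ + 1) =
      ((n + k₀ : ℕ) : ℝ) * v (n + k₀) + t * (u n + v n))
    (n : ℕ) (hm : k₀ + 1 ≤ n + k₀) :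
    v (n + k₀ + 1) / u (n + k₀ + 1) - v (n + k₀) / u (n + k₀) =
      (t * u n / (((n + k₀ + 1 : ℕ) : ℝ) * u (n + k₀ + 1))) *
        (1 + v n / u n - v (n + k₀) / u (n + k₀)) := by
  have hu1 : 0 < u (n + k₀ + 1) := u_pos ht hu0 hus hur _ (by omega)
  have hu0' : 0 < u (n + k₀) := u_pos ht hu0 hus hur _ hm
  have hN : (0 : ℝ) < ((n + k₀ + 1 : ℕ) : ℝ) := by positivity
  have hrecu := hur n
  have hrecv := hvr n
  by_cases hun : u n = 0
  · have hvn : v n = 0 := by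
      rcases Nat.eq_zero_or_pos n with rfl | hn
      · rw [hu0] at hun; exact absurd hun one_ne_zero
      · by_cases hnk : n ≤ k₀
        · exact hvs n hn hnk
        · exact absurd hun (u_pos ht hu0 hus hur n (by omega)).ne'
    rw [hun] at hrecu
    rw [hun, hvn] at hrecv
    rw [hun, hvn]
    simp only [mul_zero, add_zero, zero_div, zero_mul] at hrecu hrecv ⊢
    rw [div_sub_div _ _ hu1.ne' hu0'.ne', div_eq_zero_iff]
    left
    have e1 : u (n + k₀ + 1) = ((n + k₀ : ℕ) : ℝ) * u (n + k₀) / ((n + k₀ + 1 : ℕ) : ℝ) := by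
      rw [eq_div_iff hN.ne', mul_comm]; exact hrecu
    have e2 : v (n + k₀ + 1) = ((n + k₀ : ℕ) : ℝ) * v (n + k₀) / ((n + k₀ + 1 : ℕ) : ℝ) := by
      rw [eq_div_iff hN.ne', mul_comm]; exact hrecv
    rw [e1, e2]
    field_simp
    ring
  · have e1 : u (n + k₀ + 1) =
        (((n + k₀ : ℕ) : ℝ) * u (n + k₀) + t * u n) / ((n + k₀ + 1 : ℕ) : ℝ) := by
      rw [eq_div_iff hN.ne', mul_comm]; exact hrecu
    have e2 : v (n + k₀ + 1) =
        (((n + k₀ : ℕ) : ℝ) * v (n + k₀) + t * (u n + v n)) / ((n + k₀ + 1 : ℕ) : ℝ) := by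
      rw [eq_div_iff hN.ne', mul_comm]; exact hrecv
    rw [div_sub_div _ _ hu1.ne' hu0'.ne']
    rw [e1, e2]
    field_simp
    ring

/-- **Theorem TH (a),(b), joint form.**  For every `n ≥ k₀ + 1`:
`κ_{n+k₀} ≤ κ_{n+k₀+1}` and `κ_{n+k₀} ≤ 1 + κ_n` (`κ_j := v_j/u_j`).  Strong induction on `n`:
the recurrence makes `κ_{m+1}` a convex combination of `κ_m` and `1 + κ_{m-k₀}`. -/
theorem kappa_mono_and_bound (ht : 0 < t) (hu0 : u 0 = 1) (hv0 : v 0 = 0)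
    (hus : ∀ j, 0 < j → j ≤ k₀ → u j = 0) (hvs : ∀ j, 0 < j → j ≤ k₀ → v j = 0)
    (hur : ∀ n, ((n + k₀ + 1 : ℕ) : ℝ) * u (n + k₀ + 1) = ((n + k₀ : ℕ) : ℝ) * u (n + k₀) + t * u n)
    (hvr : ∀ n, ((n + k₀ + 1 : ℕ) : ℝ) * v (n + k₀ + 1) =
      ((n + k₀ : ℕ) : ℝ) * v (n + k₀) + t * (u n + v n)) :
    ∀ n, k₀ + 1 ≤ n →
      v (n + k₀) / u (n + k₀) ≤ v (n + k₀ + 1) / u (n + k₀ + 1) ∧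
        v (n + k₀) / u (n + k₀) ≤ 1 + v n / u n := by
  -- the bound gives the monotone step (convex combination with nonnegative weight)
  have step_of_bound : ∀ n, k₀ + 1 ≤ n → v (n + k₀) / u (n + k₀) ≤ 1 + v n / u n →
      v (n + k₀) / u (n + k₀) ≤ v (n + k₀ + 1) / u (n + k₀ + 1) := by
    intro n hn hb
    have hs := kappa_step ht hu0 hus hvs hur hvr n (by omega)
    have ha : 0 ≤ t * u n / (((n + k₀ + 1 : ℕ) : ℝ) * u (n + k₀ + 1)) :=
      div_nonneg (mul_nonneg ht.le (u_nonneg ht hu0 hus hur n))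
        (mul_nonneg (by positivity) (u_nonneg ht hu0 hus hur _))
    have : 0 ≤ v (n + k₀ + 1) / u (n + k₀ + 1) - v (n + k₀) / u (n + k₀) := by
      rw [hs]; exact mul_nonneg ha (by linarith)
    linarith
  -- flat steps on the first block
  have flat : ∀ j, k₀ + 1 ≤ j → j ≤ 2 * k₀ → v j / u j ≤ v (j + 1) / u (j + 1) := by
    intro j hj hj'
    rw [kappa_eq_one_of_le ht hu0 hv0 hus hvs hur hvr j hj (by omega),
      kappa_eq_one_of_le ht hu0 hv0 hus hvs hur hvr (j + 1) (by omega) (by omega)]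
  intro n hn
  induction n using Nat.strong_induction_on with
  | _ n ih =>
    -- all monotone steps strictly below n + k₀
    have mono_below : ∀ j, k₀ + 1 ≤ j → j < n + k₀ → v j / u j ≤ v (j + 1) / u (j + 1) := by
      intro j hj hjn
      by_cases hjf : j ≤ 2 * k₀
      · exact flat j hj hjf
      · obtain ⟨n', rfl⟩ : ∃ n', j = n' + k₀ := ⟨j - k₀, by omega⟩
        exact (ih n' (by omega) (by omega)).1
    have mono_chain : ∀ a b, k₀ + 1 ≤ a → a ≤ b → b ≤ n + k₀ → v a / u a ≤ v b / u b := by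
      intro a b ha hab hb
      induction b, hab using Nat.le_induction with
      | base => exact le_rfl
      | succ b hab ih' => exact (ih' (by omega)).trans (mono_below b (by omega) (by omega))
    have hbound : v (n + k₀) / u (n + k₀) ≤ 1 + v n / u n := by
      by_cases hn0 : n = k₀ + 1
      · subst hn0
        rw [kappa_eq_one_of_le ht hu0 hv0 hus hvs hur hvr (k₀ + 1 + k₀) (by omega) (by omega),
          kappa_eq_one_of_le ht hu0 hv0 hus hvs hur hvr (k₀ + 1) le_rfl (by omega)]
        norm_num
      · obtain ⟨p, rfl⟩ : ∃ p, n = p + 1 := ⟨n - 1, by omega⟩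
        have hp : k₀ + 1 ≤ p := by omega
        have hs := kappa_step ht hu0 hus hvs hur hvr p (by omega)
        have hup : 0 < u p := u_pos ht hu0 hus hur p hp
        have hden : 0 < ((p + k₀ + 1 : ℕ) : ℝ) * u (p + k₀ + 1) :=
          mul_pos (by positivity) (u_pos ht hu0 hus hur _ (by omega))
        have ha : 0 < t * u p / (((p + k₀ + 1 : ℕ) : ℝ) * u (p + k₀ + 1)) :=
          div_pos (mul_pos ht hup) hden
        have hstep : v (p + k₀) / u (p + k₀) ≤ v (p + k₀ + 1) / u (p + k₀ + 1) :=
          mono_below (p + k₀) (by omega) (by omega)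
        -- from the step identity with a > 0: 1 + κ_p - κ_{p+k₀} ≥ 0
        have h1 : 0 ≤ 1 + v p / u p - v (p + k₀) / u (p + k₀) := by
          have h0 : 0 ≤ v (p + k₀ + 1) / u (p + k₀ + 1) - v (p + k₀) / u (p + k₀) := by linarith
          rw [hs] at h0
          exact (mul_nonneg_iff_of_pos_left ha).1 h0
        -- a ≤ 1, hence κ_{p+k₀+1} ≤ 1 + κ_p
        have ha1 : t * u p / (((p + k₀ + 1 : ℕ) : ℝ) * u (p + k₀ + 1)) ≤ 1 := by
          rw [div_le_one hden]
          have hrecu := hur p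
          have : 0 ≤ ((p + k₀ : ℕ) : ℝ) * u (p + k₀) :=
            mul_nonneg (by positivity) (u_nonneg ht hu0 hus hur _)
          linarith
        have h2 : v (p + k₀ + 1) / u (p + k₀ + 1) ≤ 1 + v p / u p := by
          have e : v (p + k₀ + 1) / u (p + k₀ + 1) = v (p + k₀) / u (p + k₀) +
              t * u p / (((p + k₀ + 1 : ℕ) : ℝ) * u (p + k₀ + 1)) *
                (1 + v p / u p - v (p + k₀) / u (p + k₀)) := by linarith
          rw [e]
          nlinarith
        have h3 : v p / u p ≤ v (p + 1) / u (p + 1) := mono_chain p (p + 1) hp (by omega) (by omega)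
        have e' : p + 1 + k₀ = p + k₀ + 1 := by omega
        rw [e']
        linarith
    exact ⟨step_of_bound n hn hbound, hbound⟩

/-- **Theorem TH (a): monotonicity of the expected number of cycles.**
`v_a/u_a ≤ v_b/u_b` whenever `k₀ + 1 ≤ a ≤ b`. -/
theorem kappa_mono (ht : 0 < t) (hu0 : u 0 = 1) (hv0 : v 0 = 0)
    (hus : ∀ j, 0 < j → j ≤ k₀ → u j = 0) (hvs : ∀ j, 0 < j → j ≤ k₀ → v j = 0)
    (hur : ∀ n, ((n + k₀ + 1 : ℕ) : ℝ) * u (n + k₀ + 1) = ((n + k₀ : ℕ) : ℝ) * u (n + k₀) + t * u n)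
    (hvr : ∀ n, ((n + k₀ + 1 : ℕ) : ℝ) * v (n + k₀ + 1) =
      ((n + k₀ : ℕ) : ℝ) * v (n + k₀) + t * (u n + v n))
    (a b : ℕ) (ha : k₀ + 1 ≤ a) (hab : a ≤ b) : v a / u a ≤ v b / u b := by
  induction b, hab using Nat.le_induction with
  | base => exact le_rfl
  | succ b hab ih =>
    refine ih.trans ?_
    by_cases hbf : b ≤ 2 * k₀
    · rw [kappa_eq_one_of_le ht hu0 hv0 hus hvs hur hvr b (by omega) (by omega),
        kappa_eq_one_of_le ht hu0 hv0 hus hvs hur hvr (b + 1) (by omega) (by omega)]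
    · obtain ⟨n, rfl⟩ : ∃ n, b = n + k₀ := ⟨b - k₀, by omega⟩
      exact (kappa_mono_and_bound ht hu0 hv0 hus hvs hur hvr n (by omega)).1

/-- **Theorem TH (b):** `k₀` more points add at most one expected cycle:
`v_{n+k₀}/u_{n+k₀} ≤ 1 + v_n/u_n` for `n ≥ k₀ + 1`. -/
theorem kappa_le_one_add (ht : 0 < t) (hu0 : u 0 = 1) (hv0 : v 0 = 0)
    (hus : ∀ j, 0 < j → j ≤ k₀ → u j = 0) (hvs : ∀ j, 0 < j → j ≤ k₀ → v j = 0)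
    (hur : ∀ n, ((n + k₀ + 1 : ℕ) : ℝ) * u (n + k₀ + 1) = ((n + k₀ : ℕ) : ℝ) * u (n + k₀) + t * u n)
    (hvr : ∀ n, ((n + k₀ + 1 : ℕ) : ℝ) * v (n + k₀ + 1) =
      ((n + k₀ : ℕ) : ℝ) * v (n + k₀) + t * (u n + v n))
    (n : ℕ) (hn : k₀ + 1 ≤ n) : v (n + k₀) / u (n + k₀) ≤ 1 + v n / u n :=
  (kappa_mono_and_bound ht hu0 hv0 hus hvs hur hvr n hn).2

/-- Pairwise form used for the covariance inequality: for residual sizes `r' ≤ r`,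
`u_r v_{r'} ≤ v_r u_{r'}` (both sides vanish off the support; on the support this is `κ_{r'} ≤ κ_r`,
and `r' = 0` uses `v_0 = 0`). -/
theorem cross_le (ht : 0 < t) (hu0 : u 0 = 1) (hv0 : v 0 = 0)
    (hus : ∀ j, 0 < j → j ≤ k₀ → u j = 0) (hvs : ∀ j, 0 < j → j ≤ k₀ → v j = 0)
    (hur : ∀ n, ((n + k₀ + 1 : ℕ) : ℝ) * u (n + k₀ + 1) = ((n + k₀ : ℕ) : ℝ) * u (n + k₀) + t * u n)
    (hvr : ∀ n, ((n + k₀ + 1 : ℕ) : ℝ) * v (n + k₀ + 1) =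
      ((n + k₀ : ℕ) : ℝ) * v (n + k₀) + t * (u n + v n))
    (r r' : ℕ) (hr : r' ≤ r) : u r * v r' ≤ v r * u r' := by
  rcases Nat.eq_zero_or_pos r' with rfl | hr'0
  · rw [hv0, hu0, mul_zero, mul_one]; exact v_nonneg ht hu0 hv0 hus hvs hur hvr r
  by_cases hr's : r' ≤ k₀
  · rw [hus r' hr'0 hr's, hvs r' hr'0 hr's]; simp
  have hr'k : k₀ + 1 ≤ r' := by omega
  have hrk : k₀ + 1 ≤ r := by omega
  have hκ := kappa_mono ht hu0 hv0 hus hvs hur hvr r' r hr'k hr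
  rw [div_le_div_iff₀ (u_pos ht hu0 hus hur r' hr'k) (u_pos ht hu0 hus hur r hrk)] at hκ
  linarith

/-- **Theorem TH (c), abstract covariance form.**  For arbitrary nonnegative weights `w` and any
cut `M`, the upper `w·u`-average of `κ = v/u` dominates the lower one:
`(∑_{r<N, M≤r} w_r u_r)(∑_{r<N, r<M} w_r v_r) ≤ (∑_{r<N, M≤r} w_r v_r)(∑_{r<N, r<M} w_r u_r)`.
For the threshold model on `n` points (`N = n`, `w_r = t·[n - r ≥ k₀+1]`) this is
`E[#cycles | L ≤ n-M] ≥ E[#cycles | L > n-M]`, i.e. `Cov(#cycles, #points in cycles of length ≤ J) ≥ 0`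
for all `n`, `J`, every threshold and every tilt `t > 0`. -/
theorem upper_mean_ge_lower_mean (ht : 0 < t) (hu0 : u 0 = 1) (hv0 : v 0 = 0)
    (hus : ∀ j, 0 < j → j ≤ k₀ → u j = 0) (hvs : ∀ j, 0 < j → j ≤ k₀ → v j = 0)
    (hur : ∀ n, ((n + k₀ + 1 : ℕ) : ℝ) * u (n + k₀ + 1) = ((n + k₀ : ℕ) : ℝ) * u (n + k₀) + t * u n)
    (hvr : ∀ n, ((n + k₀ + 1 : ℕ) : ℝ) * v (n + k₀ + 1) =
      ((n + k₀ : ℕ) : ℝ) * v (n + k₀) + t * (u n + v n))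
    (w : ℕ → ℝ) (hw : ∀ r, 0 ≤ w r) (N M : ℕ) :
    (∑ r ∈ (range N).filter (fun r => M ≤ r), w r * u r) *
        (∑ r ∈ (range N).filter (fun r => r < M), w r * v r) ≤
      (∑ r ∈ (range N).filter (fun r => M ≤ r), w r * v r) *
        (∑ r ∈ (range N).filter (fun r => r < M), w r * u r) := by
  rw [Finset.sum_mul_sum, Finset.sum_mul_sum]
  apply Finset.sum_le_sum
  intro r hr
  apply Finset.sum_le_sum
  intro r' hr'
  simp only [Finset.mem_filter, Finset.mem_range] at hr hr'
  have hle : r' ≤ r := by omega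
  have hc := cross_le ht hu0 hv0 hus hvs hur hvr r r' hle
  have hww : 0 ≤ w r * w r' := mul_nonneg (hw r) (hw r')
  calc w r * u r * (w r' * v r') = (w r * w r') * (u r * v r') := by ring
    _ ≤ (w r * w r') * (v r * u r') := mul_le_mul_of_nonneg_left hc hww
    _ = w r * v r * (w r' * u r') := by ring

end ThresholdCycles

end Summit.CriticalPhenomena.PercolationContinuityZ3.Theorems
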